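import Summits.ResolutionOfSingularities.ResolutionOfSingularities.Theorems.EquisingularLiftEquisingularLiftNatDepthChain
import Summits.ResolutionOfSingularities.ResolutionOfSingularities.Theorems.EquisingularLiftEquisingularLiftNatIsoHypPointOfPoints
import HarnessLib

/-!
# [OURS] ★★★ FINITELY MANY SINGULAR POINTS OF FINITE BLOW-UP DEPTH, IN ANY POSITION ⟹ the lead's hypothesis #7 `IsoHypPoint` (= `PointResolvable`)
# (cruxes `Theses.EquisingularLift.EquisingularLiftNat` / `…NatThree`, stmt-ResolutionOfSingularities-20038 / -20148)

[OURS · leafhand-res-equisingularlift-10 g1, 2026-08-31; cell `pub/decomp-res`] AI-produced, weaker than expert review; NOT a statement of any manuscript;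
nothing here proves resolution of singularities in positive characteristic.  DEF-FREE helper; no `sorry`; standard axioms; ZERO named hypotheses.

The wrapper of ✓ `PointChain.chain_of_finiteDepthPoints` (previous file): `D : ℕ → Π Γ, Γ → Prop` a depth-graded point-property with

* UNFOLDING `hDstep` — a level-`d` closed point `y` of `Γ` and a blow-up `τ : Z → Γ` at the reduced point `y`: `Z` is regular over `y` except at finitely
  many CLOSED points of levels `< d` (level `0` = ONE-STEP; level `1` ⊇ TWO-STEP; …);
* LOCALITY `hDloc` — for `ρ : Γ₂ → Γ` an isomorphism over an open `U ∋ y` and closed points `y₂ ↦ y`: `D d Γ y ↔ D d Γ₂ y₂`.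

* ★★★ `isoHypPoint_of_finiteDepthPoints` — **`k = k̄`, `H` integral, `ι : H ↪ ℙⁿ_k` a closed immersion; the non-regular points of `H` form a finite set `S`
  of points with closed images, each a `D`-point of some level ⟹ `IsoHypPoint k n H ι`.**  No auxiliary point `ξ` is needed: the generic point of `H` is
  regular (its local ring is the function field).

Honest label: closes no registered stub (the registered isolated residual carries `¬ IsoHypPoint`; this certifies further `H` it excludes); instantiating
`D` by the intrinsic blow-up tower / `Aₙ, Dₙ, Eₙ` chart data is separate work.

References: [StacksProject, Tags 080E, 02OS]; [Hartshorne1977, II Ex. 7.12, V 3.9]; [GortzWedhorn2020, Prop. 13.91] — through the cited tree files.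
-/

set_option linter.dupNamespace false -- mandated namespace `Summit.<Summit>.<Problem>` of this single-conjunct summit

noncomputable section

open CategoryTheory CategoryTheory.Limits AlgebraicGeometry TopologicalSpace
open Literature.AlgebraicGeometry.Resolution Literature.AlgebraicGeometry.Motives
open AlgebraicGeometry.Scheme.IdealSheafData

namespace Summit.ResolutionOfSingularities.ResolutionOfSingularities.Cruxes.EquisingularLiftNat.Sections

/-- ★★★ **FINITELY MANY SINGULAR POINTS OF FINITE BLOW-UP DEPTH, IN ANY POSITION ⟹ `IsoHypPoint`** (the lead's hypothesis #7 = `PointResolvable`).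
`k` algebraically closed, `H` integral, `ι : H ↪ ℙⁿ_k` a closed immersion; `D` a depth-graded point-property with UNFOLDING and LOCALITY (see the module
docstring); `S` a finite set of points of `H` with closed images such that `H` is regular exactly off `S` and every `x ∈ S` is a `D`-point of some level.
Then `IsoHypPoint k n H ι`: the downstairs chain blows up the points of highest level first (✓ `PointChain.chain_of_finiteDepthPoints`; the auxiliary regular
point is the generic point of `H`). [OURS] [cite: StacksProject, Tag 080E] [cite: Hartshorne1977, II Ex. 7.12] -/
theorem isoHypPoint_of_finiteDepthPoints (k : Type) [Field k] [IsAlgClosed k] (n : ℕ) (H : Scheme.{0})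
    (ι : H ⟶ (projectiveSpace n k).left) [IsClosedImmersion ι] [IsIntegral H]
    (D : ℕ → ∀ Γ : Scheme.{0}, Γ → Prop)
    (hDstep : ∀ (d : ℕ) (Γ : Scheme.{0}) (y : Γ), D d Γ y → ∀ (hy : IsClosed ({y} : Set Γ)) (Z : Scheme.{0}) (τ : Z ⟶ Γ),
      IsBlowup τ (vanishingIdeal ⟨{y}, hy⟩) →
      ∃ S' : Finset Z, (∀ z : Z, τ z = y → z ∉ S' → IsRegularLocalRing (Z.presheaf.stalk z)) ∧
        ∀ z ∈ S', τ z = y ∧ IsClosed ({z} : Set Z) ∧ ∃ d' < d, D d' Z z)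
    (hDloc : ∀ (d : ℕ) (Γ Γ₂ : Scheme.{0}) (ρ : Γ₂ ⟶ Γ) (U : Γ.Opens), IsIso (ρ ∣_ U) → ∀ y : Γ, y ∈ U → IsClosed ({y} : Set Γ) →
      ∀ y₂ : Γ₂, ρ y₂ = y → IsClosed ({y₂} : Set Γ₂) → (D d Γ y ↔ D d Γ₂ y₂))
    (S : Finset H)
    (hcl : ∀ x ∈ S, IsClosed ({ι x} : Set (projectiveSpace n k).left))
    (hsing : ∀ x ∈ S, ¬ IsRegularLocalRing (H.presheaf.stalk x))
    (hreg : ∀ x : H, x ∉ S → IsRegularLocalRing (H.presheaf.stalk x))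
    (hdepth : ∀ x ∈ S, ∃ d, D d H x) :
    IsoHypPoint k n H ι := by
  classical
  haveI : IsLocallyNoetherian (projectiveSpace n k).left :=
    AlgebraicGeometry.LocallyOfFiniteType.isLocallyNoetherian (projectiveSpace n k).hom
  have hιinj : Function.Injective ι := ι.isClosedEmbedding.injective
  have hirr : IsIrreducible (Set.range ι) := by
    have h := (IrreducibleSpace.isIrreducible_univ H).image ι ι.continuous.continuousOn
    rwa [Set.image_univ] at h
  -- the auxiliary regular point: the generic point of `H`
  set ξ : H := genericPoint H with hξdef
  have hξreg : IsRegularLocalRing (H.presheaf.stalk ξ) := inferInstanceAs (IsRegularLocalRing H.functionField)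
  have hξ : ∀ x ∈ S, x ≠ ξ := fun x hx h => hsing x hx (by rw [h]; exact hξreg)
  -- a uniform bound on the levels
  choose δ hδ using hdepth
  obtain ⟨M, hM⟩ : ∃ M : ℕ, ∀ x (hx : x ∈ S), δ x hx < M := by
    refine ⟨(S.attach.sup fun x => δ x.1 x.2) + 1, fun x hx => Nat.lt_succ_of_le ?_⟩
    exact Finset.le_sup (f := fun x : {x // x ∈ S} => δ x.1 x.2) (Finset.mem_attach S ⟨x, hx⟩)
  -- `H ≅ V(closure ι(H))_red`, compatibly with the embeddings
  let TD : Closeds (projectiveSpace n k).left := ⟨closure (Set.range ι), isClosed_closure⟩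
  have hDker : vanishingIdeal TD = ι.ker := by
    rw [← Scheme.IdealSheafData.map_bot, ← Scheme.nilradical_eq_bot, ← Scheme.IdealSheafData.vanishingIdeal_top,
      Scheme.IdealSheafData.map_vanishingIdeal]
    congr 1
    ext1
    change closure (Set.range ι) = closure (ι '' Set.univ)
    rw [Set.image_univ]
  have hkerD : (vanishingIdeal TD).subschemeι.ker = ι.ker := by
    rw [Scheme.IdealSheafData.ker_subschemeι, hDker]
  let eD : H ⟶ (vanishingIdeal TD).subscheme := IsClosedImmersion.lift _ ι hkerD.le
  have heD : eD ≫ (vanishingIdeal TD).subschemeι = ι := IsClosedImmersion.lift_fac _ ι hkerD.le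
  haveI : IsIso eD := IsClosedImmersion.isIso_lift _ ι hkerD
  have heD_apply : ∀ x : H, (vanishingIdeal TD).subschemeι (eD x) = ι x := fun x => by rw [← Scheme.Hom.comp_apply, heD]
  have heDinj : Function.Injective eD := (Scheme.homeoOfIso (asIso eD)).injective
  have heDsurj : Function.Surjective eD := (Scheme.homeoOfIso (asIso eD)).surjective
  have hDιinj : Function.Injective (vanishingIdeal TD).subschemeι := (vanishingIdeal TD).subschemeι.isClosedEmbedding.injective
  -- transfer the hypotheses to `V(closure ι(H))_red`
  let S' : Finset ↥(vanishingIdeal TD).subscheme := S.image eD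
  have hmemS' : ∀ x', x' ∈ S' → ∃ x ∈ S, eD x = x' := fun x' hx' => by
    obtain ⟨x, hx, h⟩ := Finset.mem_image.mp hx'
    exact ⟨x, hx, h⟩
  have hmemS'' : ∀ x', x' ∈ S' ∨ x' ∈ (∅ : Finset ↥(vanishingIdeal TD).subscheme) → ∃ x ∈ S, eD x = x' := by
    rintro x' (h | h)
    · exact hmemS' x' h
    · exact absurd h (Finset.notMem_empty x')
  have hξC : ι ξ ∈ (TD : Set (projectiveSpace n k).left) := subset_closure ⟨ξ, rfl⟩
  have hξS : ∀ x', x' ∈ S' ∨ x' ∈ (∅ : Finset ↥(vanishingIdeal TD).subscheme) →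
      ((vanishingIdeal TD).subschemeι x' : (projectiveSpace n k).left) ≠ ι ξ := by
    intro x' hx' h
    obtain ⟨x, hxS, rfl⟩ := hmemS'' x' hx'
    rw [heD_apply] at h
    exact hξ x hxS (hιinj h)
  have hreg' : ∀ x' : ↥(vanishingIdeal TD).subscheme, x' ∉ S' → x' ∉ (∅ : Finset ↥(vanishingIdeal TD).subscheme) →
      IsRegularLocalRing (((vanishingIdeal TD).subscheme).presheaf.stalk x') := by
    intro x' hx₁ _
    obtain ⟨x, rfl⟩ := heDsurj x'
    have hxS : x ∉ S := fun h => hx₁ (Finset.mem_image_of_mem eD h)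
    haveI := hreg x hxS
    exact IsRegularLocalRing.of_ringEquiv (R := H.presheaf.stalk x) (asIso (eD.stalkMap x)).commRingCatIsoToRingEquiv.symm
  have hcl' : ∀ x', x' ∈ S' ∨ x' ∈ (∅ : Finset ↥(vanishingIdeal TD).subscheme) →
      IsClosed ({((vanishingIdeal TD).subschemeι x' : (projectiveSpace n k).left)} : Set (projectiveSpace n k).left) := by
    intro x' hx'
    obtain ⟨x, hxS, rfl⟩ := hmemS'' x' hx'
    rw [heD_apply]; exact hcl x hxS
  have hsing' : ∀ x', x' ∈ S' ∨ x' ∈ (∅ : Finset ↥(vanishingIdeal TD).subscheme) →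
      ¬ IsRegularLocalRing (((vanishingIdeal TD).subscheme).presheaf.stalk x') := by
    intro x' hx' h
    obtain ⟨x, hxS, rfl⟩ := hmemS'' x' hx'
    apply hsing x hxS
    haveI := h
    exact IsRegularLocalRing.of_ringEquiv (R := ((vanishingIdeal TD).subscheme).presheaf.stalk (eD x))
      (asIso (eD.stalkMap x)).commRingCatIsoToRingEquiv
  have hlo' : ∀ x' ∈ S', ∃ d < M, D d (vanishingIdeal TD).subscheme x' := by
    intro x' hx'S
    obtain ⟨x, hxS, rfl⟩ := hmemS' x' hx'S
    have hxcl : IsClosed ({x} : Set H) := PointChain.isClosed_singleton_of_injective ι hιinj (hcl x hxS)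
    have hx'cl : IsClosed ({eD x} : Set ↥(vanishingIdeal TD).subscheme) :=
      PointChain.isClosed_singleton_of_injective _ hDιinj (by rw [heD_apply]; exact hcl x hxS)
    refine ⟨δ x hxS, hM x hxS, ?_⟩
    -- LOCALITY along the isomorphism `eD⁻¹ : V(closure ι(H))_red → H` (an isomorphism over `⊤`)
    haveI : IsIso ((inv eD) ∣_ (⊤ : H.Opens)) := inferInstance
    have hinv : (inv eD) (eD x) = x := by
      change (eD ≫ inv eD) x = x
      rw [IsIso.hom_inv_id]; rfl
    exact (hDloc (δ x hxS) H _ (inv eD) ⊤ inferInstance x (Set.mem_univ x) hxcl (eD x) hinv hx'cl).mp (hδ x hxS)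
  have hhi' : ∀ x' ∈ (∅ : Finset ↥(vanishingIdeal TD).subscheme), D M (vanishingIdeal TD).subscheme x' :=
    fun x' hx' => absurd hx' (Finset.notMem_empty x')
  obtain ⟨F', ρ', T', hF', hreg''⟩ := PointChain.chain_of_finiteDepthPoints (P := (projectiveSpace n k).left) D hDstep hDloc M 0
    (projectiveSpace n k).left (𝟙 _) (Set.range ι) ι.isClosedEmbedding.isClosed_range hirr TD rfl S' ∅ rfl (ι ξ) hξC hξS
    hreg' hcl' hsing' hlo' hhi'
  exact ⟨F', ρ', T', fun Q h0 hstep => hF' Q hstep h0, hreg''⟩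

end Summit.ResolutionOfSingularities.ResolutionOfSingularities.Cruxes.EquisingularLiftNat.Sections

end
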